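import Summits.BirchSwinnertonDyer.Rank1Residual.Additive.PadicLogFormalGroup
import HarnessLib

/-!
# O5 KL3 part 12 — the unit-log binder `hQW` of the END theorems from a RATIONAL point: reading a
# base-changed `Q₀ ∈ W(ℚ)` along any embedding `K ↪ ℚ_p` gives `Q₀ ∈ W(ℚ_p)` (audit lemma, GEN 20 docket (c) /
# GEN 22 docket (e); cell `b2b-bsdres`, lane CLASS-CLOSURE, class O5; seat o5-r2 GEN 21)

HONEST FRAMING (cell `b2b-bsdres`, run/shared/lean/b2b/bsd-rank1-residual/, verbatim in every file): the goal
of the cell is to DELETE the COMBINATION-SHAPED residual classes of the Birch–Swinnerton-Dyer formula for ALL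
analytic-rank `≤ 1` elliptic curves over `ℚ` — "full BSD formula for every rank `≤ 1` curve in class `C`"
assembled STRICTLY from published theorems — so that the rank-`≤ 1` remainder becomes exactly the
CONSTRUCTION-SHAPED classes, which are TYPED (missing-input `Prop`s), NOT attempted. This is not "finishing
BSD". Lane CLASS-CLOSURE: research routes; no claim beyond the stated classes; nothing is booked here; no mark
of `RESIDUAL-MAP.md` moves; census numbers are EVIDENCE. THEOREMS ONLY (no definition, no named fact, no
conjecture node; net named-fact debt `0`); no node file is touched; O5 stays OPEN.

## What this file does (AUDIT of the census ↔ END dictionary; general prime `p`)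

The END theorems of the KL3 chain (`O5/HeegnerLogTransportThreeResidualEndFacts.lean`, part 9; and the
GEN 18/19 tree ENDs) carry the binder
`hQW : ∃ Q : (W.baseChange K).toAffine.Point, ¬ IsOfFinAddOrder Q ∧ padicLogOrd W 3 (embAt K 3 𝔭 h𝔭 he hf) Q = 0`
("a `K`-point of infinite order with unit normalised `3`-adic logarithm, read along the embedding of `𝔭`"),
while the census column `dE = 0` (`HOME/b2b-bsdres-o5-r2/gen16/kl3/kl3_pairs.tsv`) is computed from a
generator `Q₀ ∈ W(ℚ)` read in `W(ℚ₃)`. This file proves that the census datum discharges the binder, for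
every number field `K` and EVERY embedding `ι : K →+* ℚ_p` (no dependence on `𝔭`):

* `padicPointOf_map_ofId` — `(Q₀ ⊗ K)_ι = Q₀ ⊗ ℚ_p` in `W(ℚ_p)`: the two `ℚ`-algebra maps `ℚ → ℚ_p` agree.
* `padicLogOrd_map_ofId` / `padicLogOrd_map_ofId_eq` — x11b's `padicLogOrd W p ι (Q₀ ⊗ K)` is the
  `ℚ_p`-intrinsic quantity `ord_p log_W(m₀ (Q₀ ⊗ ℚ_p)) − ord_p m₀`; in particular independent of `(K, ι)`.
* `padicLogOrd_map_ofId_eq_valuation_padicLog` — for `Q₀` of infinite order it equals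
  `ord_p (padicLog (W ⊗ ℚ_p) (Q₀ ⊗ ℚ_p))`, the valuation of the `ℤ_p`-linearly extended formal logarithm of the
  cell's local-log API (`Additive.LocalLog.padicLog`, bridge `padicLogOrd_eq_valuation_padicLog`) — the census
  currency.
* **`exists_logUnit_point_of_rat`** — a rational point `Q₀ ∈ W(ℚ)` of infinite order with
  `ord_p (padicLog (W ⊗ ℚ_p) (Q₀ ⊗ ℚ_p)) = 0` yields, in every `W(K)`, a point of infinite order with
  `padicLogOrd W p ι Q = 0` — i.e. the END binder `hQW` (take `p = 3`, `ι = embAt K 3 𝔭 h𝔭 he hf`).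

Nothing here is specific to `3` or to O5; the file sits in the KL3 chain because the chain's ENDs consume it.
O5 OPEN; nothing booked; census = EVIDENCE.

References: [Castella2018] §2.2, Thm. 2.3 (arXiv:1704.06608 p. 5: `log_{ω_E} : E(K_𝔭) → ℤ_p`, `P ∈ E(K)` read in
`E(K_𝔭) = E(ℚ_p)`); [SilvermanAEC2009] IV.6.4, VII.2.2, VII.3.1 (`E(K) ⊂ E(K_v)` injective); cell files
`X11b/AnticyclotomicEmbedding.lean` (`padicPointOf`, `padicLogOrd`), `Additive/PadicLogFormalGroup.lean` (§4 bridge),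
`O5/HeegnerLogTransportThreeResidualEndFacts.lean` (the consumer's binder `hQW`).

## TYPER PLACEMENT NOTE

Imports TREE files only (`Additive/PadicLogFormalGroup.lean`). THEOREMS only, namespace
`Summit.BirchSwinnertonDyer.Rank1Residual.O5.HeegnerLogTransport`; no `def`. `lean check` rc 0, 0 sorries,
0 warnings; axioms `propext`, `Classical.choice`, `Quot.sound` (o5-r2 GEN 21). Target path
`O5/HeegnerLogTransportThreeRatLogUnit.lean` (placeable at any time).

## TYPER PLACEMENT NOTE (cc-typer-5 GEN 18 = O5 §3.5 / O6 §3.4 typer of record; by-name ask A-O5-G21-1c of o5-r2 GEN 21, HOME/INBOX.md l.14008: 'place by sha')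

Source: `HOME/b2b-bsdres-o5-r2/gen21/lean/HeegnerLogTransportThreeRatLogUnit.lean` sha16 `bfe3b6c22c077958` (149 l.; `gen21/SHA16.txt`; o5-r2's `lean check` rc 0 / 0 warnings / axioms std), re-hashed by the typer
right before writing; THIS file = KL3 part 12 = the source VERBATIM + this paragraph (imports, module text, every declaration block byte-identical; script
`class-closure/typer-5/gen18/g21b_place.py`); the typer's own farm check (this file over the tree, or jointly with its not-yet-built predecessor) rc 0 / 0 warnings, axioms std;
DEDUP `lean search --decl` on the new names: no match.  CONTENT LABELS (source, unchanged): THEOREMS ONLY — 0 `def`, 0 `@[conjecture]`, 0 Literature facts (net named-fact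
debt 0), no `sorry`; published inputs stay displayed hypotheses BY NAME.  KL3 parts in the tree: 1–3 p340741 / p341262 / p341640, Global p342632, OrdCompanion p343587 +
p344465, OrdSelmer p345030 + p345686, OrdTwist p346273, Residual Engine / Residual / End p347366 / p348865 / p350277, BaseSelmer p349318, ExactCount p349954, GoodSelmer p350559,
Literature index lemma p344022, Literature Kriz–Li Thm 1.16 fact p350088 (lit, A314).  HONEST FRAMING (cell `b2b-bsdres`): research route, lane CLASS-CLOSURE §3.5 O5; nothing asserted
beyond the displayed binders, nothing booked, no mark of `RESIDUAL-MAP.md` moves; census = EVIDENCE, never a Literature fact; O5 OPEN.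
-/

set_option autoImplicit false

noncomputable section

open scoped Classical

open WeierstrassCurve NumberField
open Summit.BirchSwinnertonDyer.Rank1Residual.X11b (padicLogOrd padicPointOf formalIndex)
open Summit.BirchSwinnertonDyer.Rank1Residual.Additive.LocalLog (padicLog padicLogOrd_eq_valuation_padicLog)

namespace Summit.BirchSwinnertonDyer.Rank1Residual.O5.HeegnerLogTransport

variable (W : WeierstrassCurve ℚ) (p : ℕ) [Fact p.Prime] {K : Type} [Field K] [NumberField K]

/-! ## §1 The `ℚ_p`-point of a base-changed rational point does not depend on the embedding -/

/-- **`(Q₀ ⊗ K)_ι = Q₀ ⊗ ℚ_p`**: reading the base change to `K` of a rational point `Q₀ ∈ W(ℚ)` along ANY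
embedding `ι : K →+* ℚ_p` gives the base change of `Q₀` to `ℚ_p` (functoriality of `Point.map` and uniqueness of
the `ℚ`-algebra map `ℚ → ℚ_p`). [folklore] -/
theorem padicPointOf_map_ofId (ι : K →+* ℚ_[p]) (Q₀ : W.toAffine.Point) :
    padicPointOf W p ι (Affine.Point.map (W' := W.toAffine) (S := ℚ) (Algebra.ofId ℚ K) Q₀) =
      Affine.Point.map (W' := W.toAffine) (S := ℚ) (Algebra.ofId ℚ ℚ_[p]) Q₀ := by
  unfold padicPointOf
  rw [Affine.Point.map_map, Subsingleton.elim (ι.toRatAlgHom.comp (Algebra.ofId ℚ K)) (Algebra.ofId ℚ ℚ_[p])]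

/-- The base change `W(ℚ) → W(K)` is injective, so it preserves "of infinite order".
[cite: SilvermanAEC2009, VII.3.1 (the setting `E(K) ⊂ E(L)`)] -/
theorem not_isOfFinAddOrder_map_ofId {L : Type} [Field L] [Algebra ℚ L] (Q₀ : W.toAffine.Point)
    (hQ₀ : ¬ IsOfFinAddOrder Q₀) :
    ¬ IsOfFinAddOrder (Affine.Point.map (W' := W.toAffine) (S := ℚ) (Algebra.ofId ℚ L) Q₀) := by
  intro h
  apply hQ₀
  have hinj := Affine.Point.map_injective (W' := W.toAffine) (f := Algebra.ofId ℚ L)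
  rw [← addOrderOf_pos_iff] at h ⊢
  rwa [addOrderOf_injective _ hinj Q₀] at h

/-! ## §2 `padicLogOrd` of a base-changed rational point is `ℚ_p`-intrinsic -/

variable [W.IsElliptic] [W.IsGloballyMinimal]

/-- **x11b's `ord_p log_{ω}` of `Q₀ ⊗ K` read along `ι` is `ord_p log_W(m₀ (Q₀ ⊗ ℚ_p)) − ord_p m₀`**,
`m₀ = [W(ℚ_p) : W₁(ℚ_p)]` — a quantity of `Q₀ ∈ W(ℚ) ⊂ W(ℚ_p)` alone.
[cite: Castella2018, §2.2 and Thm. 2.3 (arXiv:1704.06608 p. 5)] -/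
theorem padicLogOrd_map_ofId (ι : K →+* ℚ_[p]) (Q₀ : W.toAffine.Point) :
    padicLogOrd W p ι (Affine.Point.map (W' := W.toAffine) (S := ℚ) (Algebra.ofId ℚ K) Q₀) =
      ((W.baseChange ℚ_[p]).padicLogPoint
          (formalIndex W p • Affine.Point.map (W' := W.toAffine) (S := ℚ) (Algebra.ofId ℚ ℚ_[p]) Q₀)).valuation -
        (padicValNat p (formalIndex W p) : ℤ) := by
  unfold padicLogOrd
  rw [padicPointOf_map_ofId]

/-- **Independence of the field and the embedding**: for number fields `K, K'` and embeddings `ι, ι'` into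
`ℚ_p`, `padicLogOrd W p ι (Q₀ ⊗ K) = padicLogOrd W p ι' (Q₀ ⊗ K')`. (For a Heegner point, which is NOT a
base-changed rational point, only the weaker conjugation symmetry `Partition/AnticyclotomicLogConjugate` holds.)
[folklore] -/
theorem padicLogOrd_map_ofId_eq {K' : Type} [Field K'] [NumberField K'] (ι : K →+* ℚ_[p]) (ι' : K' →+* ℚ_[p])
    (Q₀ : W.toAffine.Point) :
    padicLogOrd W p ι (Affine.Point.map (W' := W.toAffine) (S := ℚ) (Algebra.ofId ℚ K) Q₀) =
      padicLogOrd W p ι' (Affine.Point.map (W' := W.toAffine) (S := ℚ) (Algebra.ofId ℚ K') Q₀) := by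
  rw [padicLogOrd_map_ofId, padicLogOrd_map_ofId]

/-- **Census currency**: for `Q₀ ∈ W(ℚ)` of infinite order,
`padicLogOrd W p ι (Q₀ ⊗ K) = ord_p (padicLog (W ⊗ ℚ_p) (Q₀ ⊗ ℚ_p))`,
the valuation of the `ℤ_p`-linearly extended formal-group logarithm of the cell's local-log API at the
`ℚ_p`-point of `Q₀` (bridge `Additive.LocalLog.padicLogOrd_eq_valuation_padicLog`).
[cite: Castella2018, §2.2 and Thm. 2.3 (arXiv:1704.06608 p. 5)]
[cite: SilvermanAEC2009, IV.6.4 and VII.6.3] -/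
theorem padicLogOrd_map_ofId_eq_valuation_padicLog (ι : K →+* ℚ_[p]) (Q₀ : W.toAffine.Point)
    (hQ₀ : ¬ IsOfFinAddOrder Q₀) :
    padicLogOrd W p ι (Affine.Point.map (W' := W.toAffine) (S := ℚ) (Algebra.ofId ℚ K) Q₀) =
      (padicLog (W.baseChange ℚ_[p])
        (Affine.Point.map (W' := W.toAffine) (S := ℚ) (Algebra.ofId ℚ ℚ_[p]) Q₀)).valuation := by
  have hnt : ¬ IsOfFinAddOrder
      (padicPointOf W p ι (Affine.Point.map (W' := W.toAffine) (S := ℚ) (Algebra.ofId ℚ K) Q₀)) := by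
    rw [padicPointOf_map_ofId]
    exact not_isOfFinAddOrder_map_ofId W Q₀ hQ₀
  rw [padicLogOrd_eq_valuation_padicLog W p ι _ hnt, padicPointOf_map_ofId]

/-! ## §3 The END binder `hQW` from a census-shaped rational datum -/

/-- **A rational point of infinite order with unit normalised `p`-adic logarithm discharges the END binder
`hQW` in EVERY `W(K)` along EVERY embedding**: given `Q₀ ∈ W(ℚ)` of infinite order with
`ord_p (padicLog (W ⊗ ℚ_p) (Q₀ ⊗ ℚ_p)) = 0` (census column `dE = 0` at `p = 3`), the point `Q₀ ⊗ K ∈ W(K)` has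
infinite order and `padicLogOrd W p ι (Q₀ ⊗ K) = 0`. For the KL3 ENDs take `p = 3`, `ι = embAt K 3 𝔭 h𝔭 he hf`.
[cite: Castella2018, §2.2 and Thm. 2.3 (arXiv:1704.06608 p. 5)] [cite: SilvermanAEC2009, VII.3.1] -/
theorem exists_logUnit_point_of_rat (ι : K →+* ℚ_[p]) (Q₀ : W.toAffine.Point) (hQ₀ : ¬ IsOfFinAddOrder Q₀)
    (hunit : (padicLog (W.baseChange ℚ_[p])
      (Affine.Point.map (W' := W.toAffine) (S := ℚ) (Algebra.ofId ℚ ℚ_[p]) Q₀)).valuation = 0) :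
    ∃ Q : (W.baseChange K).toAffine.Point, ¬ IsOfFinAddOrder Q ∧ padicLogOrd W p ι Q = 0 :=
  ⟨Affine.Point.map (W' := W.toAffine) (S := ℚ) (Algebra.ofId ℚ K) Q₀, not_isOfFinAddOrder_map_ofId W Q₀ hQ₀,
    by rw [padicLogOrd_map_ofId_eq_valuation_padicLog W p ι Q₀ hQ₀, hunit]⟩

end Summit.BirchSwinnertonDyer.Rank1Residual.O5.HeegnerLogTransport

end
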